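import Summits.AnomalousDissipation.AnomalousDissipation.Theorems.SolenoidalFractalHomogenisationPermissibleFractalCarrierTime
import HarnessLib

/-!
# K3L `LagrangianCarrierConstruction` (stmt-AnomalousDissipation-24913), line `birth`, stub `stub_flowsL`:
# the slot envelopes are locally affine from each side (helper; `--supports stmt-AnomalousDissipation-24913`)

Summits-side helper file (everything proved; no definitions, no named facts). Second brick of the Lagrangian insertion
`stub_flowsL`. The time dependence of a lattice-shear level field is carried by the periodically replayed trapezoidal slot
envelopes `t ↦ trapezoid_j (fract (a t / period) · period)`: continuous, piecewise AFFINE functions of time. Here we prove the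
form of this fact that the flow calculus (`…LagrangianCarrierConstructionFlowSmooth`) consumes: at EVERY time `r` each
envelope coincides with an affine function `α + β t` on a right neighbourhood `[r, r + ε)` and (with other coefficients) on a
left neighbourhood `(r − ε, r]` — also across the period boundary, where the envelopes vanish. Ingredients: an "eventually
affine" calculus along one-sided neighbourhood filters (constants, affine maps, `min`, `max`, composition with affine
reparametrisations), the trapezoid `max 0 (min 1 (min ((s−a)/(ρτ)) ((a+τ−s)/(ρτ))))`, and the local behaviour of
`t ↦ fract (t/P) · P` (a translation on `[r, r+ε)`; a translation on `(r−ε, r]`, through `P` instead of `0` at period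
boundaries). No statement here is specific to fluids; this is infrastructure for the construction side of route-1's rung
leaf F-D1.A0 (a frontier formal rung), NOT a proof of anomalous dissipation.
-/

set_option linter.dupNamespace false

noncomputable section

namespace Summit.AnomalousDissipation.AnomalousDissipation.Theorems.SolenoidalFractalHomogenisation.LagrangianCarrierConstruction

open Set Function Filter Topology
open Literature.Analysis.FluidPDE Literature.Analysis.FluidPDE.LatticeShear
open Summit.AnomalousDissipation.AnomalousDissipation.Theorems.SolenoidalFractalHomogenisation.PermissibleCarrier
  (trapezoid_start_zero trapezoid_start_period period_pos)

/-! ## Eventually-affine calculus along a filter of times -/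

section Affine

variable {l : Filter ℝ} {f g : ℝ → ℝ} {r : ℝ}

/-- An affine function is eventually affine (along any filter). [folklore] -/
theorem affine_near_affine (l : Filter ℝ) (c d : ℝ) : ∃ α β : ℝ, ∀ᶠ t in l, c + d * t = α + β * t :=
  ⟨c, d, Eventually.of_forall fun _ => rfl⟩

/-- A constant is eventually affine. [folklore] -/
theorem affine_near_const (l : Filter ℝ) (c : ℝ) : ∃ α β : ℝ, ∀ᶠ t in l, c = α + β * t :=
  ⟨c, 0, Eventually.of_forall fun _ => by ring⟩

/-- Sums of eventually affine functions. [folklore] -/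
theorem affine_near_add (hf : ∃ α β : ℝ, ∀ᶠ t in l, f t = α + β * t)
    (hg : ∃ α β : ℝ, ∀ᶠ t in l, g t = α + β * t) : ∃ α β : ℝ, ∀ᶠ t in l, f t + g t = α + β * t := by
  obtain ⟨a, b, hf⟩ := hf
  obtain ⟨c, d, hg⟩ := hg
  exact ⟨a + c, b + d, (hf.and hg).mono fun t h => by rw [h.1, h.2]; ring⟩

/-- Differences of eventually affine functions. [folklore] -/
theorem affine_near_sub (hf : ∃ α β : ℝ, ∀ᶠ t in l, f t = α + β * t)
    (hg : ∃ α β : ℝ, ∀ᶠ t in l, g t = α + β * t) : ∃ α β : ℝ, ∀ᶠ t in l, f t - g t = α + β * t := by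
  obtain ⟨a, b, hf⟩ := hf
  obtain ⟨c, d, hg⟩ := hg
  exact ⟨a - c, b - d, (hf.and hg).mono fun t h => by rw [h.1, h.2]; ring⟩

/-- **`min` of two eventually affine functions is eventually affine along a ONE-SIDED neighbourhood filter** of `r`
(two affine functions either differ at `r`, or agree at `r` and are then ordered by their slopes on each side). [folklore] -/
theorem affine_near_min (hl : l ≤ 𝓝 r) (hside : (∀ᶠ t in l, r ≤ t) ∨ ∀ᶠ t in l, t ≤ r)
    (hf : ∃ α β : ℝ, ∀ᶠ t in l, f t = α + β * t) (hg : ∃ α β : ℝ, ∀ᶠ t in l, g t = α + β * t) :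
    ∃ α β : ℝ, ∀ᶠ t in l, min (f t) (g t) = α + β * t := by
  obtain ⟨a, b, hf⟩ := hf
  obtain ⟨c, d, hg⟩ := hg
  rcases lt_trichotomy (a + b * r) (c + d * r) with hlt | heq | hgt
  · -- `f < g` near `r`
    have hc : ContinuousAt (fun t => (c + d * t) - (a + b * t)) r := by fun_prop
    have hev : ∀ᶠ t in 𝓝 r, 0 < (c + d * t) - (a + b * t) :=
      hc.preimage_mem_nhds (Ioi_mem_nhds (by linarith))
    exact ⟨a, b, (hf.and (hg.and (hl hev))).mono fun t h => by
      rw [h.1, h.2.1]; exact min_eq_left (by linarith [h.2.2])⟩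
  · -- the two lines meet at `r`: ordered by slope on each side
    have key : ∀ t, (a + b * t) - (c + d * t) = (b - d) * (t - r) := fun t => by linear_combination heq
    rcases hside with hR | hL
    · rcases le_or_gt b d with hbd | hdb
      · exact ⟨a, b, (hf.and (hg.and hR)).mono fun t h => by
          rw [h.1, h.2.1]
          refine min_eq_left ?_
          have := key t
          nlinarith [h.2.2]⟩
      · exact ⟨c, d, (hf.and (hg.and hR)).mono fun t h => by
          rw [h.1, h.2.1]
          refine min_eq_right ?_
          have := key t
          nlinarith [h.2.2]⟩
    · rcases le_or_gt b d with hbd | hdb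
      · exact ⟨c, d, (hf.and (hg.and hL)).mono fun t h => by
          rw [h.1, h.2.1]
          refine min_eq_right ?_
          have := key t
          nlinarith [h.2.2]⟩
      · exact ⟨a, b, (hf.and (hg.and hL)).mono fun t h => by
          rw [h.1, h.2.1]
          refine min_eq_left ?_
          have := key t
          nlinarith [h.2.2]⟩
  · -- `g < f` near `r`
    have hc : ContinuousAt (fun t => (a + b * t) - (c + d * t)) r := by fun_prop
    have hev : ∀ᶠ t in 𝓝 r, 0 < (a + b * t) - (c + d * t) :=
      hc.preimage_mem_nhds (Ioi_mem_nhds (by linarith))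
    exact ⟨c, d, (hf.and (hg.and (hl hev))).mono fun t h => by
      rw [h.1, h.2.1]; exact min_eq_right (by linarith [h.2.2])⟩

/-- `max` of two eventually affine functions along a one-sided neighbourhood filter (`max = f + g − min`). [folklore] -/
theorem affine_near_max (hl : l ≤ 𝓝 r) (hside : (∀ᶠ t in l, r ≤ t) ∨ ∀ᶠ t in l, t ≤ r)
    (hf : ∃ α β : ℝ, ∀ᶠ t in l, f t = α + β * t) (hg : ∃ α β : ℝ, ∀ᶠ t in l, g t = α + β * t) :
    ∃ α β : ℝ, ∀ᶠ t in l, max (f t) (g t) = α + β * t := by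
  obtain ⟨α, β, h⟩ := affine_near_sub (affine_near_add hf hg) (affine_near_min hl hside hf hg)
  exact ⟨α, β, h.mono fun t ht => by rw [← ht]; linarith [min_add_max (f t) (g t)]⟩

/-- Composition with an affine reparametrisation: if `g` is eventually affine along `l'`, `u → l'` along `l` and `u` is
eventually affine along `l`, then `g ∘ u` is eventually affine along `l`. [folklore] -/
theorem affine_near_comp {l l' : Filter ℝ} {g u : ℝ → ℝ} (hg : ∃ α β : ℝ, ∀ᶠ s in l', g s = α + β * s)
    (hu : Tendsto u l l') {c d : ℝ} (hu' : ∀ᶠ t in l, u t = c + d * t) :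
    ∃ α β : ℝ, ∀ᶠ t in l, g (u t) = α + β * t := by
  obtain ⟨α, β, hg⟩ := hg
  exact ⟨α + β * c, β * d, ((hu.eventually hg).and hu').mono fun t h => by rw [h.1, h.2]; ring⟩

/-- **The trapezoidal slot envelope is affine near every point, from each side.** [folklore] -/
theorem affine_near_trapezoid (a τ ρ s₀ : ℝ) (hl : l ≤ 𝓝 s₀) (hside : (∀ᶠ s in l, s₀ ≤ s) ∨ ∀ᶠ s in l, s ≤ s₀) :
    ∃ α β : ℝ, ∀ᶠ s in l, LatticeWord.trapezoid a τ ρ s = α + β * s := by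
  unfold LatticeWord.trapezoid
  have hA : ∃ α β : ℝ, ∀ᶠ s in l, (s - a) / (ρ * τ) = α + β * s :=
    ⟨-a / (ρ * τ), 1 / (ρ * τ), Eventually.of_forall fun s => by ring⟩
  have hB : ∃ α β : ℝ, ∀ᶠ s in l, (a + τ - s) / (ρ * τ) = α + β * s :=
    ⟨(a + τ) / (ρ * τ), -1 / (ρ * τ), Eventually.of_forall fun s => by ring⟩
  exact affine_near_max hl hside (affine_near_const l 0)
    (affine_near_min hl hside (affine_near_const l 1) (affine_near_min hl hside hA hB))

end Affine

/-! ## The replay clock `t ↦ fract (t/P) · P` near a point -/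

section Fract

variable {P : ℝ}

/-- To the right of any time the replay clock is a translation: `fract(t/P)·P = fract(r/P)·P + (t − r)` for
`t ∈ [r, r + P(1 − fract(r/P)))`. [folklore] -/
theorem eventually_nhdsGE_fract_mul (hP : 0 < P) (r : ℝ) :
    ∀ᶠ t in 𝓝[≥] r, Int.fract (t / P) * P = Int.fract (r / P) * P + (t - r) := by
  have hf1 : Int.fract (r / P) < 1 := Int.fract_lt_one _
  have hδ : 0 < P * (1 - Int.fract (r / P)) := mul_pos hP (by linarith)
  filter_upwards [Ico_mem_nhdsGE (show r < r + P * (1 - Int.fract (r / P)) by linarith)] with t ht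
  have hy : Int.fract (t / P) = Int.fract (r / P) + (t - r) / P := by
    rw [Int.fract_eq_iff]
    refine ⟨add_nonneg (Int.fract_nonneg _) (div_nonneg (by linarith [ht.1]) hP.le), ?_, ⌊r / P⌋, ?_⟩
    · have h1 : (t - r) / P < 1 - Int.fract (r / P) := by
        rw [div_lt_iff₀ hP]; linarith [ht.2]
      linarith
    · rw [← Int.self_sub_fract]
      field_simp
      ring
  rw [hy]
  field_simp

/-- To the left of a time that is not a period boundary the replay clock is the same translation. [folklore] -/
theorem eventually_nhdsLE_fract_mul_of_pos (hP : 0 < P) (r : ℝ) (h0 : 0 < Int.fract (r / P)) :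
    ∀ᶠ t in 𝓝[≤] r, Int.fract (t / P) * P = Int.fract (r / P) * P + (t - r) := by
  have hf1 : Int.fract (r / P) < 1 := Int.fract_lt_one _
  filter_upwards [Ioc_mem_nhdsLE (show r - P * Int.fract (r / P) < r by nlinarith)] with t ht
  have hy : Int.fract (t / P) = Int.fract (r / P) + (t - r) / P := by
    rw [Int.fract_eq_iff]
    refine ⟨?_, ?_, ⌊r / P⌋, ?_⟩
    · have h1 : -Int.fract (r / P) < (t - r) / P := by
        rw [lt_div_iff₀ hP]; linarith [ht.1]
      linarith
    · have h1 : (t - r) / P ≤ 0 := div_nonpos_of_nonpos_of_nonneg (by linarith [ht.2]) hP.le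
      linarith
    · rw [← Int.self_sub_fract]
      field_simp
      ring
  rw [hy]
  field_simp

/-- To the left of a period boundary the clock runs up to `P`, and a `P`-periodic readout `g` (`g 0 = g P`) does not see
the reset: `g (fract(t/P)·P) = g (P + (t − r))` for `t ∈ (r − P, r]`. [folklore] -/
theorem eventually_nhdsLE_comp_fract_mul_of_zero (hP : 0 < P) (r : ℝ) (h0 : Int.fract (r / P) = 0)
    {g : ℝ → ℝ} (hg : g 0 = g P) : ∀ᶠ t in 𝓝[≤] r, g (Int.fract (t / P) * P) = g (P + (t - r)) := by
  filter_upwards [Ioc_mem_nhdsLE (show r - P < r by linarith)] with t ht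
  rcases eq_or_lt_of_le ht.2 with hte | htl
  · rw [hte, h0, zero_mul, sub_self, add_zero, hg]
  · have hy : Int.fract (t / P) = 1 + (t - r) / P := by
      rw [Int.fract_eq_iff]
      refine ⟨?_, ?_, ⌊r / P⌋ - 1, ?_⟩
      · have h1 : -1 < (t - r) / P := by rw [lt_div_iff₀ hP]; linarith [ht.1]
        linarith
      · have h1 : (t - r) / P < 0 := div_neg_of_neg_of_pos (by linarith) hP
        linarith
      · have hr : r / P = ⌊r / P⌋ := by
          have := Int.self_sub_fract (r / P)
          rw [h0, sub_zero] at this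
          exact this
        push_cast
        rw [← hr]
        field_simp
        ring
    rw [hy]
    congr 1
    field_simp

end Fract

/-! ## The replayed envelopes of a word -/

section Envelope

variable {k : ℕ}

/-- An affine change of time `t ↦ s₀ + a (t − r)` (`a > 0`) maps right neighbourhoods of `r` to right neighbourhoods of
`s₀`. [folklore] -/
theorem tendsto_affine_nhdsGE {a : ℝ} (ha : 0 < a) (s₀ r : ℝ) :
    Tendsto (fun t => s₀ + a * (t - r)) (𝓝[≥] r) (𝓝[≥] s₀) := by
  have hc : ContinuousWithinAt (fun t => s₀ + a * (t - r)) (Ici r) r := by fun_prop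
  have hmaps : MapsTo (fun t => s₀ + a * (t - r)) (Ici r) (Ici s₀) := fun t ht => by
    simp only [mem_Ici] at ht ⊢; nlinarith
  have h := hc.tendsto_nhdsWithin hmaps
  simpa using h

/-- The same change of time maps left neighbourhoods of `r` to left neighbourhoods of `s₀`. [folklore] -/
theorem tendsto_affine_nhdsLE {a : ℝ} (ha : 0 < a) (s₀ r : ℝ) :
    Tendsto (fun t => s₀ + a * (t - r)) (𝓝[≤] r) (𝓝[≤] s₀) := by
  have hc : ContinuousWithinAt (fun t => s₀ + a * (t - r)) (Iic r) r := by fun_prop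
  have hmaps : MapsTo (fun t => s₀ + a * (t - r)) (Iic r) (Iic s₀) := fun t ht => by
    simp only [mem_Iic] at ht ⊢; nlinarith
  have h := hc.tendsto_nhdsWithin hmaps
  simpa using h

/-- **The replayed envelope of a slot is affine on a right neighbourhood of every time.** [folklore] -/
theorem affine_near_envelope_right (W : LatticeWord k) (j : Fin k) {a : ℝ} (ha : 0 < a) (r : ℝ) :
    ∃ α β : ℝ, ∀ᶠ t in 𝓝[≥] r, LatticeWord.trapezoid (W.start j) (W.phase j).τ W.ramp
      (Int.fract (a * t / W.period) * W.period) = α + β * t := by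
  have hP := period_pos W
  set s₀ : ℝ := Int.fract (a * r / W.period) * W.period with hs₀
  -- the clock after the change of time `t ↦ a t`
  have hclock : ∀ᶠ t in 𝓝[≥] r, Int.fract (a * t / W.period) * W.period = s₀ + a * (t - r) := by
    have h := (tendsto_affine_nhdsGE ha (a * r) r).eventually (eventually_nhdsGE_fract_mul hP (a * r))
    filter_upwards [h] with t ht
    have e : a * r + a * (t - r) = a * t := by ring
    rw [e] at ht
    rw [ht, hs₀]
    ring
  have htrap := affine_near_trapezoid (W.start j) (W.phase j).τ W.ramp s₀ (l := 𝓝[≥] s₀) nhdsWithin_le_nhds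
    (Or.inl (eventually_mem_nhdsWithin))
  obtain ⟨α, β, h⟩ := affine_near_comp (u := fun t => s₀ + a * (t - r)) htrap (tendsto_affine_nhdsGE ha s₀ r)
    (c := s₀ - a * r) (d := a) (Eventually.of_forall fun t => by ring)
  exact ⟨α, β, (hclock.and h).mono fun t ht => by rw [ht.1]; exact ht.2⟩

/-- **The replayed envelope of a slot is affine on a left neighbourhood of every time** (also across period boundaries,
where it vanishes on both sides). [folklore] -/
theorem affine_near_envelope_left (W : LatticeWord k) (j : Fin k) {a : ℝ} (ha : 0 < a) (r : ℝ) :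
    ∃ α β : ℝ, ∀ᶠ t in 𝓝[≤] r, LatticeWord.trapezoid (W.start j) (W.phase j).τ W.ramp
      (Int.fract (a * t / W.period) * W.period) = α + β * t := by
  have hP := period_pos W
  have hg0 : LatticeWord.trapezoid (W.start j) (W.phase j).τ W.ramp 0 =
      LatticeWord.trapezoid (W.start j) (W.phase j).τ W.ramp W.period := by
    rw [trapezoid_start_zero, trapezoid_start_period]
  -- a base point `s₀` such that the envelope reads `trapezoid (s₀ + a (t - r))` to the left of `r`
  obtain ⟨s₀, hclock⟩ : ∃ s₀ : ℝ, ∀ᶠ t in 𝓝[≤] r,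
      LatticeWord.trapezoid (W.start j) (W.phase j).τ W.ramp (Int.fract (a * t / W.period) * W.period) =
        LatticeWord.trapezoid (W.start j) (W.phase j).τ W.ramp (s₀ + a * (t - r)) := by
    rcases eq_or_lt_of_le (Int.fract_nonneg (a * r / W.period)) with h0 | hpos
    · refine ⟨W.period, ?_⟩
      have h := (tendsto_affine_nhdsLE ha (a * r) r).eventually
        (eventually_nhdsLE_comp_fract_mul_of_zero hP (a * r) h0.symm
          (g := LatticeWord.trapezoid (W.start j) (W.phase j).τ W.ramp) hg0)
      filter_upwards [h] with t ht
      have e : a * r + a * (t - r) = a * t := by ring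
      rw [e] at ht
      rw [ht]
      ring_nf
    · refine ⟨Int.fract (a * r / W.period) * W.period, ?_⟩
      have h := (tendsto_affine_nhdsLE ha (a * r) r).eventually (eventually_nhdsLE_fract_mul_of_pos hP (a * r) hpos)
      filter_upwards [h] with t ht
      have e : a * r + a * (t - r) = a * t := by ring
      rw [e] at ht
      rw [ht]
      ring_nf
  have htrap := affine_near_trapezoid (W.start j) (W.phase j).τ W.ramp s₀ (l := 𝓝[≤] s₀) nhdsWithin_le_nhds
    (Or.inr (eventually_mem_nhdsWithin))
  obtain ⟨α, β, h⟩ := affine_near_comp (u := fun t => s₀ + a * (t - r)) htrap (tendsto_affine_nhdsLE ha s₀ r)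
    (c := s₀ - a * r) (d := a) (Eventually.of_forall fun t => by ring)
  exact ⟨α, β, (hclock.and h).mono fun t ht => by rw [ht.1]; exact ht.2⟩

/-- All envelopes of a word at once, on a right neighbourhood: `∃ ε > 0` and coefficients with
`envelope_j (t) = α_j + β_j t` for `t ∈ [r, r + ε]`, every `j`. [folklore] -/
theorem exists_affine_envelopes_right (W : LatticeWord k) {a : ℝ} (ha : 0 < a) (r : ℝ) :
    ∃ ε > 0, ∃ α β : Fin k → ℝ, ∀ t ∈ Icc r (r + ε), ∀ j, LatticeWord.trapezoid (W.start j) (W.phase j).τ W.ramp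
      (Int.fract (a * t / W.period) * W.period) = α j + β j * t := by
  choose α β h using fun j => affine_near_envelope_right W j ha r
  have hall : ∀ᶠ t in 𝓝[≥] r, ∀ j, LatticeWord.trapezoid (W.start j) (W.phase j).τ W.ramp
      (Int.fract (a * t / W.period) * W.period) = α j + β j * t := eventually_all.2 h
  obtain ⟨u, hu, hsub⟩ := mem_nhdsGE_iff_exists_Icc_subset.1 hall
  have hru : r < u := hu
  exact ⟨u - r, by linarith, α, β, fun t ht j => hsub ⟨ht.1, by linarith [ht.2]⟩ j⟩

/-- All envelopes of a word at once, on a left neighbourhood. [folklore] -/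
theorem exists_affine_envelopes_left (W : LatticeWord k) {a : ℝ} (ha : 0 < a) (r : ℝ) :
    ∃ ε > 0, ∃ α β : Fin k → ℝ, ∀ t ∈ Icc (r - ε) r, ∀ j, LatticeWord.trapezoid (W.start j) (W.phase j).τ W.ramp
      (Int.fract (a * t / W.period) * W.period) = α j + β j * t := by
  choose α β h using fun j => affine_near_envelope_left W j ha r
  have hall : ∀ᶠ t in 𝓝[≤] r, ∀ j, LatticeWord.trapezoid (W.start j) (W.phase j).τ W.ramp
      (Int.fract (a * t / W.period) * W.period) = α j + β j * t := eventually_all.2 h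
  obtain ⟨u, hu, hsub⟩ := mem_nhdsLE_iff_exists_Icc_subset.1 hall
  have hur : u < r := hu
  exact ⟨r - u, by linarith, α, β, fun t ht j => hsub ⟨by linarith [ht.1], ht.2⟩ j⟩

end Envelope

end Summit.AnomalousDissipation.AnomalousDissipation.Theorems.SolenoidalFractalHomogenisation.LagrangianCarrierConstruction

end
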